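import Summits.CriticalPhenomena.PercolationContinuityZ3.Theorems.SahiMasterFamilyPointwiseTensor
import Summits.CriticalPhenomena.PercolationContinuityZ3.Theorems.PercNearOneGluingNoHeavyLowerTailSahiCombDisjunctThreeIdentities
import Summits.CriticalPhenomena.PercolationContinuityZ3.Theorems.SahiMasterFamilyRigidityAllSections
import Summits.CriticalPhenomena.PercolationContinuityZ3.Theorems.SahiMasterFamilyLower

/-!
# Two one-coordinate gluing identities for `E_3` with explicit nonnegative pieces: a member REQUIRING a coordinate, or two
# members IMPLIED by a coordinate — with the remaining members depending on that coordinate ARBITRARILY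

Unit `prim-master-conj` (crux anchor stmt-CriticalPhenomena-4575, helper work), gen 15; memo
`run/shared/lean/prim/prim-l12/prim-master-conj/POINTWISE.md` §16.

Write `t = p_e`, `m X = μ_p(X)`, `X^b = secAt e b X` for the two `e`-sections, `ν_X = m X¹ − m X⁰ ≥ 0` (increasing `X`), `S_e = {ω | e ∈ ω}`.
For increasing events `A, B` (ARBITRARY dependence on `e`) and an `e`-free increasing event `C` (resp. `e`-free `B, C`):

* **(A) conjunctive pinning** (`sahiE_three_interCoord_eq`):
  `E_3(A, B, C ∩ S_e) = t·E_3(A¹, B¹, C) + t(1−t)·[ν_A·Cov(B¹,C) + ν_B·Cov(A¹,C) + m C·(m(A¹∩B¹) − m(A⁰∩B⁰))] + t(1−t)²·m C·ν_A·ν_B`;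
* **(B) double disjunctive gluing** (`sahiE_three_unionCoord_two_free`):
  `E_3(A, B ∪ S_e, C ∪ S_e) = (1−t)²·E_3(A⁰, B, C) + t(1−t)²·ν_A·m Bᶜ·m Cᶜ + t(1−t)·[ν_A·m (B∩C)ᶜ + m(A⁰ ∩ Bᶜ ∩ Cᶜ) + Cov(A⁰, B∩C)]`
  (P3's `sahiE_three_unionCoord_two` is the case `ν_A = 0`, i.e. `A` also `e`-free).
Both are `ring` identities after one-coordinate conditioning (`ex_ind_eq_secAt`).  Every bracketed piece is a nonnegative TRANSFERABLE atom
(Harris covariances of increasing events — zero at one interior point iff zero everywhere, `cov_ind_eq_zero_transfer`; probabilities of events —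
zero iff the event is empty, `ex_ind_eq_zero_transfer`).  CONSEQUENCES (companion file `…PointwiseCoordinateGluingSettled`): `C_3` and the full pointwise statement ("settled": `E_3 ≥ 0` and
`E_3 = 0 ↔ Z_3` at every interior parameter) pass from the `1`-minor `(A¹, B¹, C)` to `(A, B, C ∩ S_e)` — a triple ONE MEMBER OF WHICH REQUIRES
`e` — and from the `0`-minor `(A⁰, B, C)` to `(A, B ∪ S_e, C ∪ S_e)` — TWO MEMBERS IMPLIED BY `e` — the remaining members arbitrary.  This file:
the atoms (§0) and the two identities (§1, §2).
HONEST FRAMING: identities and bookkeeping; Kahn's Conjecture 5 / `MasterFamilyEqIff 3` remain OPEN.  Axioms standard. [this work]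
-/

noncomputable section

open scoped Classical

namespace Summit.CriticalPhenomena.PercolationContinuityZ3.Theorems

open Finset Function
open Literature.Combinatorics.Sahi2008
open Literature.Probability.Percolation.DecisionTree (ind ind_of_mem ind_of_not_mem ind_nonneg)
open SahiCombDisjunct

namespace Pointwise

variable {ι : Type} [Fintype ι]

/-! ### 0. Atoms: differences of nested probabilities, complements, a Venn cell -/

omit [Fintype ι] in
/-- The coordinate event `{e ∈ ω}` is increasing. [folklore] -/
theorem isUpperSet_coordEvent (e : ι) : IsUpperSet {ω : Set ι | e ∈ ω} := fun _ _ h hω => h hω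

omit [Fintype ι] in
/-- `1_{Y ∖ X} = 1_Y − 1_X` for `X ⊆ Y`. [folklore] -/
theorem ind_sdiff_of_subset {X Y : Set (Set ι)} (h : X ⊆ Y) (ω : Set ι) : ind (Y \ X) ω = ind Y ω - ind X ω := by
  by_cases hY : ω ∈ Y
  · by_cases hX : ω ∈ X
    · rw [ind_of_mem hY, ind_of_mem hX, ind_of_not_mem (fun hm => hm.2 hX)]; norm_num
    · rw [ind_of_mem hY, ind_of_not_mem hX, ind_of_mem (show ω ∈ Y \ X from ⟨hY, hX⟩)]; norm_num
  · rw [ind_of_not_mem hY, ind_of_not_mem (fun hX => hY (h hX)), ind_of_not_mem (fun hm => hY hm.1)]; norm_num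

/-- `μ(Y) − μ(X) = μ(Y ∖ X)` for `X ⊆ Y`. [folklore] -/
theorem ex_ind_sub_of_subset (μ : Set ι → ℝ) {X Y : Set (Set ι)} (h : X ⊆ Y) :
    ex μ (ind Y) - ex μ (ind X) = ex μ (ind (Y \ X)) := by
  rw [← ex_sub']
  congr 1
  funext ω
  rw [Pi.sub_apply, ind_sdiff_of_subset h]

/-- `1 − μ_p(X) = μ_p(Xᶜ)`. [folklore] -/
theorem one_sub_ex_ind (p : ι → unitInterval) (X : Set (Set ι)) :
    1 - ex (bernoulliWeight p) (ind X) = ex (bernoulliWeight p) (ind Xᶜ) := by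
  have h : ind Xᶜ = (1 : Set ι → ℝ) - ind X := by funext ω; rw [Pi.sub_apply, Pi.one_apply, ind_compl_apply]
  rw [h, ex_sub', ex_one (sum_bernoulliWeight p)]

/-- The Venn cell `μ(A ∩ Bᶜ ∩ Cᶜ) = μA − μ(A∩B) − μ(A∩C) + μ(A∩B∩C)`. [folklore] -/
theorem ex_ind_inter_compl_compl (μ : Set ι → ℝ) (A B C : Set (Set ι)) :
    ex μ (ind (A ∩ Bᶜ ∩ Cᶜ)) = ex μ (ind A) - ex μ (ind (A ∩ B)) - ex μ (ind (A ∩ C)) + ex μ (ind (A ∩ B ∩ C)) := by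
  have h : ind (A ∩ Bᶜ ∩ Cᶜ) = ind A - ind (A ∩ B) - ind (A ∩ C) + ind (A ∩ B ∩ C) := by
    funext ω
    simp only [Pi.add_apply, Pi.sub_apply, Literature.Probability.Percolation.BHK2006.ind_inter, ind_compl_apply]
    ring
  rw [h, ex_add, ex_sub', ex_sub']

/-- For an increasing event the `0`-section lies below the `1`-section, so `ν_A = μ(A¹) − μ(A⁰) ≥ 0`. [folklore] -/
theorem ex_secAt_true_sub_false_nonneg (p : ι → unitInterval) (e : ι) {A : Set (Set ι)} (hA : IsUpperSet A) :
    0 ≤ ex (bernoulliWeight p) (ind (secAt e true A)) - ex (bernoulliWeight p) (ind (secAt e false A)) := by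
  rw [ex_ind_sub_of_subset _ (RigidityAll.secAt_false_subset_secAt_true e hA)]
  exact ex_ind_nonneg' p _

/-- Transfer of `ν_A = 0`: if `μ_p(A¹) = μ_p(A⁰)` at one interior `p` then at every `q` (indeed `A¹ = A⁰`). [this work] -/
theorem ex_secAt_sub_eq_zero_transfer {p : ι → unitInterval} (hp : ∀ f, (p f : ℝ) ∈ Set.Ioo (0 : ℝ) 1) (q : ι → unitInterval)
    (e : ι) {A : Set (Set ι)} (hA : IsUpperSet A)
    (h : ex (bernoulliWeight p) (ind (secAt e true A)) - ex (bernoulliWeight p) (ind (secAt e false A)) = 0) :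
    ex (bernoulliWeight q) (ind (secAt e true A)) - ex (bernoulliWeight q) (ind (secAt e false A)) = 0 := by
  rw [ex_ind_sub_of_subset _ (RigidityAll.secAt_false_subset_secAt_true e hA)] at h ⊢
  exact ex_ind_eq_zero_transfer hp q _ h

/-- Transfer of `μ(Y) − μ(X) = 0` for nested events `X ⊆ Y`. [this work] -/
theorem ex_sub_eq_zero_transfer_of_subset {p : ι → unitInterval} (hp : ∀ f, (p f : ℝ) ∈ Set.Ioo (0 : ℝ) 1) (q : ι → unitInterval)
    {X Y : Set (Set ι)} (hXY : X ⊆ Y) (h : ex (bernoulliWeight p) (ind Y) - ex (bernoulliWeight p) (ind X) = 0) :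
    ex (bernoulliWeight q) (ind Y) - ex (bernoulliWeight q) (ind X) = 0 := by
  rw [ex_ind_sub_of_subset _ hXY] at h ⊢
  exact ex_ind_eq_zero_transfer hp q _ h

/-- Transfer of `1 − μ(X) = 0`. [this work] -/
theorem one_sub_ex_eq_zero_transfer {p : ι → unitInterval} (hp : ∀ f, (p f : ℝ) ∈ Set.Ioo (0 : ℝ) 1) (q : ι → unitInterval)
    (X : Set (Set ι)) (h : 1 - ex (bernoulliWeight p) (ind X) = 0) : 1 - ex (bernoulliWeight q) (ind X) = 0 := by
  rw [one_sub_ex_ind] at h ⊢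
  exact ex_ind_eq_zero_transfer hp q _ h

/-! ### 1. (A) Conjunctive pinning: `E_3(A, B, C ∩ {e ∈ ω})` -/

section Pinning

variable (p : ι → unitInterval) (e : ι) (A B C : Set (Set ι)) (hCe : ∀ b : Bool, secAt e b C = C)
include hCe

attribute [local simp] secAt_inter secAt_union secAt_true_coord secAt_false_coord

/-- **Identity (A), conjunctive pinning.**  For events `A, B` and an `e`-free event `C`, with `t = p_e`, `X^b = secAt e b X`, `m = μ_p`:
`E_3(1_A, 1_B, 1_{C ∩ {e∈ω}}) = t·E_3(1_{A¹},1_{B¹},1_C) + t(1−t)·[(mA¹−mA⁰)·Cov(B¹,C) + (mB¹−mB⁰)·Cov(A¹,C) + mC·(m(A¹∩B¹) − m(A⁰∩B⁰))]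
+ t(1−t)²·mC·(mA¹−mA⁰)(mB¹−mB⁰)`. [this work] -/
theorem sahiE_three_interCoord_eq :
    sahiE (bernoulliWeight p) 3 ![ind A, ind B, ind (C ∩ {ω : Set ι | e ∈ ω})] =
      (p e : ℝ) * sahiE (bernoulliWeight p) 3 ![ind (secAt e true A), ind (secAt e true B), ind C]
      + (p e : ℝ) * (1 - (p e : ℝ)) *
        ((ex (bernoulliWeight p) (ind (secAt e true A)) - ex (bernoulliWeight p) (ind (secAt e false A))) *
            (ex (bernoulliWeight p) (ind (secAt e true B ∩ C)) -
              ex (bernoulliWeight p) (ind (secAt e true B)) * ex (bernoulliWeight p) (ind C))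
          + (ex (bernoulliWeight p) (ind (secAt e true B)) - ex (bernoulliWeight p) (ind (secAt e false B))) *
            (ex (bernoulliWeight p) (ind (secAt e true A ∩ C)) -
              ex (bernoulliWeight p) (ind (secAt e true A)) * ex (bernoulliWeight p) (ind C))
          + ex (bernoulliWeight p) (ind C) *
            (ex (bernoulliWeight p) (ind (secAt e true A ∩ secAt e true B)) -
              ex (bernoulliWeight p) (ind (secAt e false A ∩ secAt e false B))))
      + (p e : ℝ) * (1 - (p e : ℝ)) ^ 2 *
        (ex (bernoulliWeight p) (ind C) *
          ((ex (bernoulliWeight p) (ind (secAt e true A)) - ex (bernoulliWeight p) (ind (secAt e false A))) *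
            (ex (bernoulliWeight p) (ind (secAt e true B)) - ex (bernoulliWeight p) (ind (secAt e false B))))) := by
  have hA : ex (bernoulliWeight p) (ind A) = (p e : ℝ) * ex (bernoulliWeight p) (ind (secAt e true A)) +
      (1 - (p e : ℝ)) * ex (bernoulliWeight p) (ind (secAt e false A)) := ex_ind_eq_secAt p e A
  have hB : ex (bernoulliWeight p) (ind B) = (p e : ℝ) * ex (bernoulliWeight p) (ind (secAt e true B)) +
      (1 - (p e : ℝ)) * ex (bernoulliWeight p) (ind (secAt e false B)) := ex_ind_eq_secAt p e B
  have hC : ex (bernoulliWeight p) (ind (C ∩ {ω : Set ι | e ∈ ω})) =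
      (p e : ℝ) * ex (bernoulliWeight p) (ind C) + (1 - (p e : ℝ)) * ex (bernoulliWeight p) (ind (∅ : Set (Set ι))) :=
    ex_ind_of_secAt p e (by simp [hCe]) (by simp [hCe])
  have hAB : ex (bernoulliWeight p) (ind (A ∩ B)) = (p e : ℝ) * ex (bernoulliWeight p) (ind (secAt e true A ∩ secAt e true B)) +
      (1 - (p e : ℝ)) * ex (bernoulliWeight p) (ind (secAt e false A ∩ secAt e false B)) :=
    ex_ind_of_secAt p e (by simp) (by simp)
  have hAC : ex (bernoulliWeight p) (ind (A ∩ (C ∩ {ω : Set ι | e ∈ ω}))) =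
      (p e : ℝ) * ex (bernoulliWeight p) (ind (secAt e true A ∩ C)) + (1 - (p e : ℝ)) * ex (bernoulliWeight p) (ind (∅ : Set (Set ι))) :=
    ex_ind_of_secAt p e (by simp [hCe]) (by simp [hCe])
  have hBC : ex (bernoulliWeight p) (ind (B ∩ (C ∩ {ω : Set ι | e ∈ ω}))) =
      (p e : ℝ) * ex (bernoulliWeight p) (ind (secAt e true B ∩ C)) + (1 - (p e : ℝ)) * ex (bernoulliWeight p) (ind (∅ : Set (Set ι))) :=
    ex_ind_of_secAt p e (by simp [hCe]) (by simp [hCe])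
  have hABC : ex (bernoulliWeight p) (ind (A ∩ B ∩ (C ∩ {ω : Set ι | e ∈ ω}))) =
      (p e : ℝ) * ex (bernoulliWeight p) (ind (secAt e true A ∩ secAt e true B ∩ C)) +
        (1 - (p e : ℝ)) * ex (bernoulliWeight p) (ind (∅ : Set (Set ι))) :=
    ex_ind_of_secAt p e (by simp [hCe]) (by simp [hCe])
  rw [sahiE_three, sahiE_three]
  simp only [ind_mul_ind_eq_inter]
  rw [hA, hB, hC, hAB, hAC, hBC, hABC, ex_ind_empty]
  ring

end Pinning

/-! ### 2. (B) Double disjunctive gluing: `E_3(A, B ∪ {e ∈ ω}, C ∪ {e ∈ ω})` with `A` arbitrary -/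

section Gluing

variable (p : ι → unitInterval) (e : ι) (A B C : Set (Set ι)) (hBe : ∀ b : Bool, secAt e b B = B) (hCe : ∀ b : Bool, secAt e b C = C)
include hBe hCe

attribute [local simp] secAt_inter secAt_union secAt_true_coord secAt_false_coord

/-- **Identity (B), double disjunctive gluing with a free third member.**  For an event `A` and `e`-free events `B, C`, `t = p_e`, `m = μ_p`:
`E_3(1_A, 1_{B∪{e}}, 1_{C∪{e}}) = (1−t)²·E_3(1_{A⁰},1_B,1_C) + t(1−t)²·(mA¹−mA⁰)(1−mB)(1−mC)
+ t(1−t)·[(mA¹−mA⁰)(1−m(B∩C)) + (mA⁰ − m(A⁰∩B) − m(A⁰∩C) + m(A⁰∩B∩C)) + (m(A⁰∩B∩C) − mA⁰·m(B∩C))]`. [this work] -/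
theorem sahiE_three_unionCoord_two_free :
    sahiE (bernoulliWeight p) 3 ![ind A, ind (B ∪ {ω : Set ι | e ∈ ω}), ind (C ∪ {ω : Set ι | e ∈ ω})] =
      (1 - (p e : ℝ)) ^ 2 * sahiE (bernoulliWeight p) 3 ![ind (secAt e false A), ind B, ind C]
      + (p e : ℝ) * (1 - (p e : ℝ)) ^ 2 *
        ((ex (bernoulliWeight p) (ind (secAt e true A)) - ex (bernoulliWeight p) (ind (secAt e false A))) *
          (1 - ex (bernoulliWeight p) (ind B)) * (1 - ex (bernoulliWeight p) (ind C)))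
      + (p e : ℝ) * (1 - (p e : ℝ)) *
        ((ex (bernoulliWeight p) (ind (secAt e true A)) - ex (bernoulliWeight p) (ind (secAt e false A))) *
            (1 - ex (bernoulliWeight p) (ind (B ∩ C)))
          + (ex (bernoulliWeight p) (ind (secAt e false A)) - ex (bernoulliWeight p) (ind (secAt e false A ∩ B))
              - ex (bernoulliWeight p) (ind (secAt e false A ∩ C)) + ex (bernoulliWeight p) (ind (secAt e false A ∩ B ∩ C)))
          + (ex (bernoulliWeight p) (ind (secAt e false A ∩ B ∩ C)) -
              ex (bernoulliWeight p) (ind (secAt e false A)) * ex (bernoulliWeight p) (ind (B ∩ C)))) := by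
  have hA : ex (bernoulliWeight p) (ind A) = (p e : ℝ) * ex (bernoulliWeight p) (ind (secAt e true A)) +
      (1 - (p e : ℝ)) * ex (bernoulliWeight p) (ind (secAt e false A)) := ex_ind_eq_secAt p e A
  have hB : ex (bernoulliWeight p) (ind (B ∪ {ω : Set ι | e ∈ ω})) =
      (p e : ℝ) * ex (bernoulliWeight p) (ind (Set.univ : Set (Set ι))) + (1 - (p e : ℝ)) * ex (bernoulliWeight p) (ind B) :=
    ex_ind_of_secAt p e (by simp [hBe]) (by simp [hBe])
  have hC : ex (bernoulliWeight p) (ind (C ∪ {ω : Set ι | e ∈ ω})) =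
      (p e : ℝ) * ex (bernoulliWeight p) (ind (Set.univ : Set (Set ι))) + (1 - (p e : ℝ)) * ex (bernoulliWeight p) (ind C) :=
    ex_ind_of_secAt p e (by simp [hCe]) (by simp [hCe])
  have hAB : ex (bernoulliWeight p) (ind (A ∩ (B ∪ {ω : Set ι | e ∈ ω}))) =
      (p e : ℝ) * ex (bernoulliWeight p) (ind (secAt e true A)) + (1 - (p e : ℝ)) * ex (bernoulliWeight p) (ind (secAt e false A ∩ B)) :=
    ex_ind_of_secAt p e (by simp [hBe]) (by simp [hBe])
  have hAC : ex (bernoulliWeight p) (ind (A ∩ (C ∪ {ω : Set ι | e ∈ ω}))) =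
      (p e : ℝ) * ex (bernoulliWeight p) (ind (secAt e true A)) + (1 - (p e : ℝ)) * ex (bernoulliWeight p) (ind (secAt e false A ∩ C)) :=
    ex_ind_of_secAt p e (by simp [hCe]) (by simp [hCe])
  have hBC : ex (bernoulliWeight p) (ind ((B ∪ {ω : Set ι | e ∈ ω}) ∩ (C ∪ {ω : Set ι | e ∈ ω}))) =
      (p e : ℝ) * ex (bernoulliWeight p) (ind (Set.univ : Set (Set ι))) + (1 - (p e : ℝ)) * ex (bernoulliWeight p) (ind (B ∩ C)) :=
    ex_ind_of_secAt p e (by simp [hBe, hCe]) (by simp [hBe, hCe])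
  have hABC : ex (bernoulliWeight p) (ind (A ∩ (B ∪ {ω : Set ι | e ∈ ω}) ∩ (C ∪ {ω : Set ι | e ∈ ω}))) =
      (p e : ℝ) * ex (bernoulliWeight p) (ind (secAt e true A)) +
        (1 - (p e : ℝ)) * ex (bernoulliWeight p) (ind (secAt e false A ∩ B ∩ C)) :=
    ex_ind_of_secAt p e (by simp [hBe, hCe]) (by simp [hBe, hCe])
  rw [sahiE_three, sahiE_three]
  simp only [ind_mul_ind_eq_inter]
  rw [hA, hB, hC, hAB, hAC, hBC, hABC, ex_ind_univ]
  ring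

end Gluing

end Pointwise

end Summit.CriticalPhenomena.PercolationContinuityZ3.Theorems
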